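import Summits.AtomisticToContinuum.Crystallization.Theorems.FrustratedLawDichotomyCellF1cNearTabB
import Summits.AtomisticToContinuum.Crystallization.Theorems.FrustratedLawDichotomyCellF1cNearTabC
import Summits.AtomisticToContinuum.Crystallization.Theorems.FrustratedLawDichotomyCellF1cNearTabD
import Summits.AtomisticToContinuum.Crystallization.Theorems.FrustratedLawDichotomyCellF1cNearTabE
import Summits.AtomisticToContinuum.Crystallization.Theorems.FrustratedLawDichotomyCellF1cNearTabF
import Summits.AtomisticToContinuum.Crystallization.Theorems.FrustratedLawDichotomyAtlasReachF1
import Summits.AtomisticToContinuum.Crystallization.Theorems.FrustratedLawDichotomyPeriodicEnergyCeilingKernel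

/-!
# FrustratedLawDichotomy · crux `AperiodicFrustratedLawGap` (stmt-AtomisticToContinuum-27623) — class-A K-file tower, layer 10c:
# ★★★ THE F1 K-CERTIFICATE `CertF1c`, UNCONDITIONAL — the F1 (228) triple closes (decomp-a2c hand-2 g49; critic r1849 (A)(2) MUST-FINISH «F1 triple»)

The NASH near column is read off the six landed tables #123–#128 `…CellF1cNearTab{A,…,F}` (239 leaves, one per `rep16`-class of the NASH list
`MNc = (ballL MF1c zT 124 0) ∖ 0`, each checked by the kernel against #122 `nnCheck`), lifted to all 2898 labels of `MNc` by #116 `nn_of_reps_aF1c`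
(Stab16 symmetry of the box, the template and the multipliers), summed exactly (`NNQ = Σ_{MNc} b(rep16 m)`), and fed to #121 `certF1c_of_nn` with the ONE
decided inequality `2·(cUp + mc) ≤ KF1Q − NNQ/1024` at `cUp = −7175/10⁴`, ★ `mc = 23/10⁴`:

* `lookupN` (the six trees in turn) + `lookup_ok` (a found leaf passes `okLeaf`: #88 `BT.all_find`); `nnQ r` := the found number, `0` if absent;
* `hit` — ONE kernel decision over the 2898 labels of the NASH list: the leaf found at `keyR (rep16 m)` carries the label `rep16 m`;
* `hrep_F1c` — per representative, `‖ψ(‖pos r‖²)•pos r − certCoeffNearL …‖ ≤ nnQ r` for every `F ∈ BF1` (#122 `hrep_of_nnCheck`); `hnn_F1c` — for every label of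
  `MNc` with `nnQ (rep16 m)` (#116); `NNQ`, `hNN_F1c` (the exact fold); `cert_ineq` (decided);
* ★★★ `certF1c : CertF1c (fun F m => posL F (omF1 m)) (−7175/10⁴) (23/10⁴)` — the K-certificate interface of #110, DISCHARGED;
* ★★ `hfloor_KF1c` — THE F1 ROW FLOOR, UNCONDITIONAL: every rooted `7/10`-hard-core NASH configuration of the row of record `KF1c` has root energy
  `≥ e⋆ + 23/10⁴` (#110 `hfloor_KF1c_of_cert` + tree `…PeriodicEnergyCeilingKernel.eStar_le : e⋆ ≤ −7175/10⁴`) — the (228) `hfloor` line of the class-A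
  F1 row, by name, no hypothesis;
* ★★ `coherentMassExclusion_F1` — #120 made UNCONDITIONAL: no admissible minimising law is `(1 − reach (23/10⁴) D_univ)`-coherent with {F1}
  (`reach ≈ 1.3·10⁻⁵`); `aperiodicFrustratedLawGap_of_offAtlasMassGap_F1` — the crux ⟸ its off-{F1} residual, by name.
MARGIN LEDGER (FULL units, kernel-exact): `KF1Q = −1.425381583` (#121), `NNQ = 5.0141239`, `NNQ/1024 = 0.0048966`, `2·cUp = −1.435`
⇒ slack `0.0047218 = 2·mc_max`, i.e. `mc_max = 0.0023609/root`; filed `mc = 0.0023` (census F1-WIDTH-56 predicted `≈ +0.004` with the Lipschitz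
recipe; the all-integer boxes cost `≈ 0.0016/root` more — levers: R_N 8, per-label `Lh`, the 86-key star).
Imports TREE #123–#128 `…CellF1cNearTab{A..F}`, #120 `…AtlasReachF1`, `…PeriodicEnergyCeilingKernel` (route-own `eStar_le`); 0 sorry.  Tags: [new: K-file certificate].
-/

noncomputable section

namespace Summit.AtomisticToContinuum.Crystallization.Theorems.FrustratedLawDichotomyCellF1cCert

open MeasureTheory
open scoped BigOperators
open Literature.MathematicalPhysics.StatisticalMechanics (lennardJones rootEnergy)
open Literature.Probability.Process (IsRootedHardCore)
open Summit.AtomisticToContinuum.Crystallization.Theorems.ChargedEnergyGapNegative (E3 eStar)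
open Summit.AtomisticToContinuum.Crystallization.Theorems.FrustratedLawDichotomyCoherentFloorAlgebra (psiT)
open Summit.AtomisticToContinuum.Crystallization.Theorems.FrustratedLawDichotomyCellTails (certCoeffNearL)
open Summit.AtomisticToContinuum.Crystallization.Theorems.FrustratedLawDichotomyCellMetric (posL)
open Summit.AtomisticToContinuum.Crystallization.Theorems.FrustratedLawDichotomyCellClasses (ballL ballL_subset)
open Summit.AtomisticToContinuum.Crystallization.Theorems.FrustratedLawDichotomyCellTriples (zT)
open Summit.AtomisticToContinuum.Crystallization.Theorems.FrustratedLawDichotomyCellBST (BT)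
open Summit.AtomisticToContinuum.Crystallization.Theorems.FrustratedLawDichotomyCellStab16 (rep16)
open Summit.AtomisticToContinuum.Crystallization.Theorems.FrustratedLawDichotomyCellF1Labels (MIF1)
open Summit.AtomisticToContinuum.Crystallization.Theorems.FrustratedLawDichotomyCellF1cLabels (MF1c)
open Summit.AtomisticToContinuum.Crystallization.Theorems.FrustratedLawDichotomyCellF1Symm (BF1)
open Summit.AtomisticToContinuum.Crystallization.Theorems.FrustratedLawDichotomyCellF1Pos (aF1)
open Summit.AtomisticToContinuum.Crystallization.Theorems.FrustratedLawDichotomyCellF1Omega (omF1 hω_F1)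
open Summit.AtomisticToContinuum.Crystallization.Theorems.FrustratedLawDichotomyCellF1cLists (ballF1c' sum_ballL_MF1c_erase ballL_MF1c_erase_eq)
open Summit.AtomisticToContinuum.Crystallization.Theorems.FrustratedLawDichotomyCellF1cSymm (rep16_mem_Mc)
open Summit.AtomisticToContinuum.Crystallization.Theorems.FrustratedLawDichotomyCellF1cNear (nn_of_reps_aF1c)
open Summit.AtomisticToContinuum.Crystallization.Theorems.FrustratedLawDichotomyCellF1cRow (KF1c CertF1c hfloor_KF1c_of_cert)
open Summit.AtomisticToContinuum.Crystallization.Theorems.FrustratedLawDichotomyCellF1cFloor (MNc KF1Q certF1c_of_nn)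
open Summit.AtomisticToContinuum.Crystallization.Theorems.FrustratedLawDichotomyCellF1cNearKit (nnCheck hrep_of_nnCheck)
open Summit.AtomisticToContinuum.Crystallization.Theorems.FrustratedLawDichotomyCellF1cNearTab
  (Leaf keyR bOf okLeaf treeA treeB treeC treeD treeE treeF treeA_ok treeB_ok treeC_ok treeD_ok treeE_ok treeF_ok)
open Summit.AtomisticToContinuum.Crystallization.Theorems.FrustratedLawDichotomyAtlasReach (reach Duniv CoherentMassExclusion OffAtlasMassGap)
open Summit.AtomisticToContinuum.Crystallization.Theorems.FrustratedLawDichotomyAtlasReachF1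
  (coherentMassExclusion_F1c aperiodicFrustratedLawGap_of_offAtlasMassGap_F1c)
open Summit.AtomisticToContinuum.Crystallization.Theorems.FrustratedLawDichotomyPeriodicEnergyCeilingKernel (eStar_le)

/-! ## §1 The table lookup and its soundness -/

/-- lookup of a key in the six tables (first hit). -/
def lookupN (q : ℤ) : Option Leaf :=
  ((((treeA.find q <|> treeB.find q) <|> treeC.find q) <|> treeD.find q) <|> treeE.find q) <|> treeF.find q

/-- an `<|>` of two table lookups returns a leaf of one of them. -/
theorem orElse_eq_some {a b : Option Leaf} {e : Leaf} (h : (a <|> b) = some e) : a = some e ∨ b = some e := by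
  cases a with
  | none => right; simpa using h
  | some v => left; simpa using h

/-- ★ a found leaf passes the leaf check at the queried key (#88 `BT.all_find` on each table). -/
theorem lookup_ok {q : ℤ} {e : Leaf} (h : lookupN q = some e) : okLeaf q e = true := by
  unfold lookupN at h
  rcases orElse_eq_some h with h | h
  · rcases orElse_eq_some h with h | h
    · rcases orElse_eq_some h with h | h
      · rcases orElse_eq_some h with h | h
        · rcases orElse_eq_some h with h | h
          · exact BT.all_find treeA_ok h
          · exact BT.all_find treeB_ok h
        · exact BT.all_find treeC_ok h
      · exact BT.all_find treeD_ok h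
    · exact BT.all_find treeE_ok h
  · exact BT.all_find treeF_ok h

/-- ★ THE NASH NUMBER OF A REPRESENTATIVE: the number of the leaf found at its key (`0` if none — never used on `MNc`). -/
def nnQ (r : ℤ × ℤ × ℤ) : ℚ :=
  match lookupN (keyR r) with
  | some e => bOf e
  | none => 0

/-- ★ THE HIT-CHECK (ONE kernel decision over the 2898 labels of the NASH list): the leaf at `keyR (rep16 m)` exists and carries `rep16 m`. -/
theorem hit : ((ballF1c' 124 0).all fun m => match lookupN (keyR (rep16 m)) with
    | some e => decide (e.1 = rep16 m)
    | none => false) = true := by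
  decide +kernel

/-- unpacked hit at a label of the NASH list. -/
theorem hit_at {m : ℤ × ℤ × ℤ} (hm : m ∈ MNc) : ∃ e, lookupN (keyR (rep16 m)) = some e ∧ e.1 = rep16 m := by
  have hmL : m ∈ ballF1c' 124 0 := by
    have h := hm
    unfold MNc at h
    rw [ballL_MF1c_erase_eq, List.mem_toFinset] at h
    exact h
  have h := List.all_eq_true.mp hit m hmL
  revert h
  cases lookupN (keyR (rep16 m)) with
  | none => simp
  | some e => intro h; exact ⟨e, rfl, of_decide_eq_true h⟩

/-! ## §2 The NASH near column over `MNc` -/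

/-- the representative set of the NASH list and its facts. -/
theorem reps_subset_Mc : MNc.image rep16 ⊆ MF1c := by
  intro r hr
  obtain ⟨m, hm, rfl⟩ := Finset.mem_image.mp hr
  exact rep16_mem_Mc (ballL_subset _ _ _ _ (Finset.mem_of_mem_erase (show m ∈ (ballL MF1c zT 124 0).erase 0 from hm)))

/-- ★ PER REPRESENTATIVE (every `F` of the cell): the NASH residual at `r` is below `nnQ r` (#122 `hrep_of_nnCheck` on the found leaf). -/
theorem hrep_F1c : ∀ F ∈ BF1, ∀ r ∈ MNc.image rep16, ‖psiT (‖posL F (aF1 r)‖ ^ 2) • posL F (aF1 r)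
    - certCoeffNearL MF1c MIF1 (fun x => posL F (aF1 x)) (fun x => posL F (omF1 x)) (ballL MF1c zT 23) r‖ ≤ ((nnQ r : ℚ) : ℝ) := by
  intro F hF r hr
  obtain ⟨m, hm, rfl⟩ := Finset.mem_image.mp hr
  obtain ⟨e, he, he1⟩ := hit_at hm
  have hok := lookup_ok he
  simp only [okLeaf, Bool.and_eq_true, decide_eq_true_eq] at hok
  obtain ⟨⟨-, hne⟩, hc⟩ := hok
  rw [he1] at hne hc
  have hval : nnQ (rep16 m) = bOf e := by unfold nnQ; rw [he]
  rw [hval]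
  exact hrep_of_nnCheck (reps_subset_Mc hr) hne hc F hF

/-- ★★ THE NASH NEAR COLUMN over the whole NASH list `MNc` (#116 `nn_of_reps_aF1c`: Stab16 symmetry). -/
theorem hnn_F1c : ∀ F ∈ BF1, ∀ m ∈ MNc, ‖psiT (‖posL F (aF1 m)‖ ^ 2) • posL F (aF1 m)
    - certCoeffNearL MF1c MIF1 (fun x => posL F (aF1 x)) (fun x => posL F (omF1 x)) (ballL MF1c zT 23) m‖ ≤ ((nnQ (rep16 m) : ℚ) : ℝ) :=
  nn_of_reps_aF1c omF1 hω_F1 23 reps_subset_Mc (fun _ hm => Finset.mem_image_of_mem rep16 hm) (fun r => ((nnQ r : ℚ) : ℝ)) hrep_F1c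

/-- ★ THE EXACT NASH SUM over `MNc` (a fold over the 2898-label list). -/
def NNQ : ℚ := ((ballF1c' 124 0).map fun m => nnQ (rep16 m)).sum

/-- the Finset sum IS the fold. -/
theorem NNQ_eq : ∑ m ∈ MNc, nnQ (rep16 m) = NNQ := by
  unfold MNc NNQ
  exact sum_ballL_MF1c_erase 124 0 (fun m => nnQ (rep16 m))

/-- … cast to `ℝ`. -/
theorem hNN_F1c : ∑ m ∈ MNc, ((nnQ (rep16 m) : ℚ) : ℝ) ≤ ((NNQ : ℚ) : ℝ) := by
  rw [← NNQ_eq, Rat.cast_sum]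

/-- ★ THE ONE DECIDED INEQUALITY: `2·(cUp + mc) ≤ KF1Q − NNQ/1024` at `cUp = −7175/10⁴`, `mc = 23/10⁴`. -/
theorem cert_ineq : 2 * ((-(7175 / 10000) : ℚ) + 23 / 10000) ≤ KF1Q - 1 / 1024 * NNQ := by
  decide +kernel

/-! ## §3 ★★★ The certificate and its unconditional consequences -/

/-- ★★★ **THE F1 K-CERTIFICATE, UNCONDITIONAL**: `2·(−7175/10⁴ + 23/10⁴) ≤ certFloorL MF1c MIF1 0 (posF1 F) (posL F ∘ omF1) 2⁻¹⁰ 13` for every `F ∈ BF1`.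
[new: K-file certificate] -/
theorem certF1c : CertF1c (fun F m => posL F (omF1 m)) (-(7175 / 10000) : ℚ) (23 / 10000 : ℚ) :=
  certF1c_of_nn (fun m => ((nnQ (rep16 m) : ℚ) : ℝ)) NNQ hnn_F1c hNN_F1c cert_ineq

/-- ★★ **THE F1 ROW FLOOR, UNCONDITIONAL** (the (228) `hfloor` line of the class-A F1 row of record): every rooted `7/10`-hard-core NASH configuration
in `KF1c` has root energy `≥ e⋆ + 23/10⁴`. [new: K-file certificate] -/
theorem hfloor_KF1c : ∀ μ : Measure E3, IsRootedHardCore (7 / 10) μ →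
    (∀ p : E3, μ {p} ≠ 0 → ∀ w : E3, (∀ q : E3, μ {q} ≠ 0 → q ≠ p → w ≠ q) →
      ∑' q : {q : E3 // μ {q} ≠ 0 ∧ q ≠ p}, lennardJones (dist p (q : E3)) ≤
        ∑' q : {q : E3 // μ {q} ≠ 0 ∧ q ≠ p}, lennardJones (dist w (q : E3))) →
    μ ∈ KF1c → eStar + 23 / 10000 ≤ rootEnergy lennardJones μ := by
  have hc : eStar ≤ ((-(7175 / 10000) : ℚ) : ℝ) := by push_cast; exact eStar_le
  have h := hfloor_KF1c_of_cert hc certF1c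
  push_cast at h
  exact h

/-- ★★ **#120 MADE UNCONDITIONAL**: no admissible minimising law is `(1 − reach (23/10⁴) D_univ)`-coherent with the one-row atlas {F1}.
[new: K-file certificate] -/
theorem coherentMassExclusion_F1 : CoherentMassExclusion 1 (fun _ => KF1c) (reach (23 / 10000) Duniv) := by
  have hc : eStar ≤ ((-(7175 / 10000) : ℚ) : ℝ) := by push_cast; exact eStar_le
  have h := coherentMassExclusion_F1c hc certF1c (by norm_num)
  push_cast at h
  exact h

/-- ★ the crux ⟸ its off-{F1} residual, unconditionally in the floors. [new: K-file certificate] -/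
theorem aperiodicFrustratedLawGap_of_offAtlasMassGap_F1 (hA : OffAtlasMassGap 1 (fun _ => KF1c) (reach (23 / 10000) Duniv)) :
    Summit.AtomisticToContinuum.Crystallization.Theses.FrustratedLawDichotomy.AperiodicFrustratedLawGap := by
  have hc : eStar ≤ ((-(7175 / 10000) : ℚ) : ℝ) := by push_cast; exact eStar_le
  have h := aperiodicFrustratedLawGap_of_offAtlasMassGap_F1c hc certF1c (by norm_num)
  push_cast at h
  exact h hA

end Summit.AtomisticToContinuum.Crystallization.Theorems.FrustratedLawDichotomyCellF1cCert

end
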